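import Summits.HodgeConjecture.HodgeConjecture.Theorems.R90S1UnitaryParabolicInductionSemisimple
import Summits.HodgeConjecture.HodgeConjecture.Theorems.R90S1InjectivePrincipalSeriesRegularIrreducible
import Summits.HodgeConjecture.HodgeConjecture.Theorems.R90S1SplitInducedIrreducibleSupercuspidal
import Summits.HodgeConjecture.HodgeConjecture.Theorems.R90S1UnitarizableCentralCharacterGLTwo
import Summits.HodgeConjecture.HodgeConjecture.Theorems.K2E3GL3InductionInStagesEquiv
import Summits.HodgeConjecture.HodgeConjecture.Theorems.K2E3GLnPrincipalBlockEmbedding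
import Summits.HodgeConjecture.HodgeConjecture.Theorems.K2E3GL2PrincipalBlockCases
import Summits.HodgeConjecture.HodgeConjecture.Theorems.K2E3GL3PrincipalSeriesThreeCell
import Summits.HodgeConjecture.HodgeConjecture.Theorems.K2E3GL3PrincipalSeriesIrreducibleUnlinked
import Summits.HodgeConjecture.HodgeConjecture.Theorems.K2E3GL3UnitaryPrincipalSeriesIrregular
import Summits.HodgeConjecture.HodgeConjecture.Theorems.K2E3GL3StandardModuleEmbedding
import Summits.HodgeConjecture.HodgeConjecture.Theorems.K2E3GL2UnlinkedIrreducible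
import Summits.HodgeConjecture.HodgeConjecture.Theorems.K2E3TwoBlockCuspidalSupportEmbedding
import Literature.NumberTheory.Automorphic.ParabolicIndGLNoSupercuspidalSubquotient
import Literature.NumberTheory.Automorphic.PrincipalSeriesGL2SatakeParameters
import Literature.NumberTheory.Automorphic.ParabolicInductionSupercuspidalProofs
import Literature.NumberTheory.Automorphic.PAdicRepsJacquetAdmissibilityProofs
import Literature.NumberTheory.Automorphic.Liu2021.LemD1SplitPlaceOfFacts
import Literature.NumberTheory.Automorphic.SmoothInductionParabolicNontrivial
import Literature.NumberTheory.Automorphic.RestrictedTensorProductIrreducibleProofs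
import Literature.NumberTheory.Automorphic.IrreducibleClasses
import Literature.NumberTheory.Automorphic.ParabolicGLExactProofs
import Literature.NumberTheory.Automorphic.CartanDecompositionGLnPowers
import Literature.RepresentationTheory.Semisimple.UnitarizableAdmissibleSemisimple
import HarnessLib

/-!
# R90-TF · S1 #7 for `σ₂` on `GL₂(F)` — `Ind_{P₍₂,₁₎}^{GL₃(F)}(σ₂ ⊠ χ′)` is irreducible for `σ₂` irreducible smooth unitarizable and `χ′` unitary

Cell `hodgecm-mathlib`, programme R90-TF (HUMAN RULING «R90-TF SLAB — MAX PUSH»), section S1 «Ch10-local», seat R90-C10-p01 (g0), road α′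
«COMPLETE REDUCIBILITY + REGULAR WEIGHTS»; the `GL₂(F)`-form of the socket S1#7 `stub_S1_split_parabolicInd_irreducible_of_unitary`
(`Cruxes/H413/Lines/R90_S1_SplitLocalPacketsB.lean`), consumed by the closing file `Theorems/R90S1SplitInducedIrreducibleOfEndScalar`.
THEOREMS ONLY (one public theorem, two private helpers); no definition, no named fact, no `sorry`.

THE MATHEMATICS ([Bernstein1984]; [Zelevinsky1980, Thm. 4.2, Thm. 9.7]; [BernsteinZelevinsky1977, Thm. 2.9, Thm. 4.2, §2.3]; [Rogawski1990, §13.3 p. 201, §4.13 p. 64]).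
`σ₂` irreducible smooth unitarizable on `W`, `χ′` unitary continuous, `Π = Ind_{P₍₂,₁₎}(σ₂ ⊠ χ′)` in ★ in-stages' `box` currency (labelling `![false,false,true]`).
* `σ₂` SUPERCUSPIDAL: ★ `isIrreducible_parabolicIndGL_box_of_isSupercuspidal` (`Theorems/R90S1SplitInducedIrreducibleSupercuspidal`).
* `σ₂` NOT supercuspidal: Harish-Chandra (★ `isSupercuspidal_iff_jacquetGL_holds`) gives a non-zero Borel Jacquet module, ★ A1
  (`exists_character_injective_intertwiningMap_parabolicIndGL`) an embedding `σ₂ ↪ I(x, y)` with `x, y` of open kernel; then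
  `Π ↪ Ind(I(x,y) ⊠ χ′) ≅ I(x, y, χ′)` (★ `parabolicIndGLMap_injective`, ★ `exists_equiv_parabolicIndGL_twoOne_box`).  `Π` is unitarizable
  (★ `isUnitarizable_parabolicIndGL_of_isUnitarizable`), admissible (★ `IsAdmissible.of_injective`), hence completely reducible (★ Getz–Hahn Ex. 5.4).
  The central character of `σ₂` is unitary: `‖x u‖ ‖y u‖ = 1` (★ `norm_mul_norm_eq_one_of_injective_principalSeries_two`, `Theorems/R90S1UnitarizableCentralCharacterGLTwo`: the scalar `u·1` acts on `I(x,y)` by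
  `x(u) y(u)`, ★ `parabolicIndGL_apply_of_mem_center`, `δ_B(u·1) = 1`).  If `(x, y, χ′)` is REGULAR, ★ `isIrreducible_of_injective_principalSeries_three_of_regular`
  (`Theorems/R90S1InjectivePrincipalSeriesRegularIrreducible`) concludes.  If not, all three letters have unit modulus, so no two are linked
  (`ne_mul_unramifiedTwist_of_norm_eq_one`, evaluation at a uniformizer), and `I(x, y, χ′)` is irreducible (★ `isIrreducible_principalSeries_three_of_unlinked` with the
  weak 3-cell lemma ★ `principalSeriesThreeCell_of_middle_of_open` + ★ letters, or ★ `isIrreducible_parabolicIndGL_id_three_self` when `x = y = χ′`); a non-zero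
  representation embedding into an irreducible one is irreducible (private `isIrreducible_of_injective_of_isIrreducible`).
The complementary-series boundary is never needed: a hypothetical link `x = χ′ν^{±1}` makes `(x, y, χ′)` regular (unit central character), and complete
reducibility + weight one still yields irreducibility.
HONEST LABEL: HC_CM is proved only modulo the 7 printed citations (2 remaining named inputs: hLiu418 = stmt-HodgeConjecture-24832,
h413 = stmt-HodgeConjecture-24833) until rung 0 closes; count-neutral helper (`--supports stmt-HodgeConjecture-24833 --as helper`).
-/

set_option autoImplicit false
set_option linter.dupNamespace false

noncomputable section

open scoped ComplexConjugate

namespace Summit.HodgeConjecture.HodgeConjecture.R90.S1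

open Literature.NumberTheory Literature.NumberTheory.Automorphic

/-! ## §M1 Generic: a non-zero representation embedding into an irreducible one is irreducible -/

section Generic

variable {G : Type*} [Group G] {V V' : Type*} [AddCommGroup V] [Module ℂ V] [AddCommGroup V'] [Module ℂ V']

/-- A representation on a non-zero space admitting an INJECTIVE intertwining map into an irreducible representation is irreducible
(its image is a non-zero subrepresentation, hence everything). [cite: BernsteinZelevinsky1977, §2.3] -/
private theorem isIrreducible_of_injective_of_isIrreducible {ρ : Representation ℂ G V} {σ : Representation ℂ G V'} [Nontrivial V]
    [σ.IsIrreducible] (φ : ρ.IntertwiningMap σ) (hφ : Function.Injective φ) : ρ.IsIrreducible := by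
  haveI : Nontrivial (Subrepresentation ρ) :=
    ⟨⟨⊥, ⊤, fun h => by
      obtain ⟨v, hv⟩ := exists_ne (0 : V)
      have hv' : v ∈ (⊤ : Subrepresentation ρ) := trivial
      rw [← h] at hv'
      exact hv hv'⟩⟩
  refine IsSimpleOrder.mk fun A => ?_
  -- the image of `A`
  let N : Subrepresentation σ :=
    ⟨A.toSubmodule.map φ.toLinearMap, by
      rintro g _ ⟨a, ha, rfl⟩
      refine ⟨ρ g a, A.apply_mem_toSubmodule g ha, ?_⟩
      exact LinearMap.congr_fun (φ.isIntertwining' g) a⟩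
  rcases IsSimpleOrder.eq_bot_or_eq_top N with hN | hN
  · left
    apply Subrepresentation.toSubmodule_injective
    change A.toSubmodule = ⊥
    rw [eq_bot_iff]
    intro a ha
    have : φ.toLinearMap a ∈ N.toSubmodule := ⟨a, ha, rfl⟩
    rw [hN] at this
    have h0 : φ a = 0 := this
    exact (hφ (h0.trans (map_zero φ).symm) : a = 0)
  · right
    apply Subrepresentation.toSubmodule_injective
    change A.toSubmodule = ⊤
    rw [eq_top_iff]
    intro v _
    have : φ.toLinearMap v ∈ N.toSubmodule := by rw [hN]; trivial
    obtain ⟨a, ha, hav⟩ := this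
    have : a = v := hφ hav
    rw [← this]
    exact ha

end Generic

/-! ## §M3 The socket for `σ` on `GL₂(F)` in the labelling `![false,false,true]` -/

section Main

open Summit.HodgeConjecture.HodgeConjecture.Cruxes.H413
open Literature.NumberTheory.GaloisRepresentations Literature.NumberTheory.GaloisRepresentations.IsNonarchimedeanLocalField
open ValuativeRel Valued

variable {F : Type} [Field F] [ValuativeRel F] [TopologicalSpace F] [IsNonarchimedeanLocalField F]

/-- **Unit-modulus characters are never linked**: if `‖x t‖ = ‖y t‖ = 1` for all `t` then `y ≠ x · ν` (`ν = ‖·‖_F`, evaluated at a uniformizer).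
[cite: BernsteinZelevinsky1977, Thm. 4.2 Remark (1) p. 455] [cite: Zelevinsky1980, §4.1] -/
private theorem ne_mul_unramifiedTwist_of_norm_eq_one (x y : Fˣ →* ℂˣ) (hx : ∀ t, ‖((x t : ℂˣ) : ℂ)‖ = 1) (hy : ∀ t, ‖((y t : ℂˣ) : ℂ)‖ = 1) :
    y ≠ x * ((unramifiedTwist F 1 : QuasiChar F).toMonoidHom) := by
  intro h
  obtain ⟨ϖ, hϖ⟩ := Literature.NumberTheory.Automorphic.exists_isUniformizingElement (F := F)
  have hv : normAbs F ϖ < 1 := (normAbs_lt_one_iff (F := F)).2 hϖ.valuation_lt_one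
  have h1 := hy (Units.mk0 ϖ hϖ.ne_zero)
  rw [h, MonoidHom.mul_apply, Units.val_mul, norm_mul, hx, one_mul, K2E3GL2UnlinkedIrreducible.coe_unramifiedTwist_one,
    Complex.norm_real, Real.norm_eq_abs, Units.val_mk0, abs_of_nonneg (NNReal.coe_nonneg _)] at h1
  have : (normAbs F ϖ : ℝ) < 1 := by exact_mod_cast hv
  exact (ne_of_lt this) h1


set_option maxHeartbeats 400000 in
/-- **S1#7 FOR `σ` ON `GL₂(F)`, LABELLING `![false,false,true]`.**  For an irreducible smooth unitarizable `σ₂` of `GL₂(F)` on `W : Type` and a unitary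
continuous `χ′`, the normalised induction `Ind_{P₍₂,₁₎}^{GL₃(F)}(σ₂ ⊠ χ′)` — with the Levi datum spelled as ★ `K2E3GL3InductionInStagesEquiv`'s `box σ₂ χ′`
along a block equivalence `e` — is IRREDUCIBLE.  Supercuspidal `σ₂`: ★ `isIrreducible_parabolicIndGL_twoOne` (relabelled to `![0,0,1]`).  Otherwise ★ A1
embeds `σ₂ ↪ I(x,y)`, so `Ind(σ₂ ⊠ χ′) ↪ Ind(I(x,y) ⊠ χ′) ≅ I(x,y,χ′)` (★ exactness + ★ induction in stages); `Ind(σ₂ ⊠ χ′)` is completely reducible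
(unitary induction, `isUnitarizable_parabolicIndGL_of_isUnitarizable` + ★ Getz–Hahn Ex. 5.4); if `(x, y, χ′)` is REGULAR the regular-weight criterion
applies; if not, the unitarity of the central character (`‖x‖‖y‖ = 1`) forces `‖x‖ = ‖y‖ = ‖χ′‖ = 1`, no two letters are linked, and `I(x,y,χ′)` is
irreducible (★ `isIrreducible_principalSeries_three_of_unlinked` ∕ ★ `isIrreducible_parabolicIndGL_id_three_self`, weak 3-cell lemma ★ E4b), whence so is
its non-zero subrepresentation `Ind(σ₂ ⊠ χ′)`. [cite: Bernstein1984, Thm. (unitary parabolic induction)] [cite: Zelevinsky1980, Thm. 4.2, Thm. 9.7]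
[cite: BernsteinZelevinsky1977, Thm. 2.9, Thm. 4.2, §2.3] [cite: Rogawski1990, §13.3 p. 201; §4.13 p. 64] -/
theorem isIrreducible_parabolicIndGL_box_of_isUnitarizable
    (e : Fin 2 ≃ {i : Fin 3 // (![false, false, true] : Fin 3 → Bool) i = false})
    (he : ∀ j : Fin 2, ((e j : {i : Fin 3 // (![false, false, true] : Fin 3 → Bool) i = false}) : Fin 3) = Fin.castSucc j)
    [LocallyCompactSpace (standardParabolicGL F (![false, false, true] : Fin 3 → Bool))]
    {W : Type} [AddCommGroup W] [Module ℂ W] (σ₂ : Representation ℂ (GL (Fin 2) F) W)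
    (hσi : σ₂.IsIrreducible) (hσs : σ₂.IsSmooth) (hσu : σ₂.IsUnitarizable)
    (χ' : Fˣ →* ℂˣ) (hχ'u : ∀ t, ‖((χ' t : ℂˣ) : ℂ)‖ = 1) (hχ'c : Continuous fun t => ((χ' t : ℂˣ) : ℂ)) :
    (Representation.parabolicIndGL F (![false, false, true] : Fin 3 → Bool)
      (Representation.twist ((σ₂.comp (reindexGL e).symm.toMonoidHom).comp
        (Pi.evalMonoidHom (fun a : Bool => GL {i : Fin 3 // (![false, false, true] : Fin 3 → Bool) i = a} F) false))
        ((χ'.comp Matrix.GeneralLinearGroup.det).comp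
          (Pi.evalMonoidHom (fun a : Bool => GL {i : Fin 3 // (![false, false, true] : Fin 3 → Bool) i = a} F) true)))).IsIrreducible := by
  classical
  haveI := hσi
  haveI : Nontrivial W := Representation.IsIrreducible.nontrivial σ₂
  have hχ'o : IsOpen ((χ'.ker : Subgroup Fˣ) : Set Fˣ) := Liu2021.SplitPlace.isOpen_ker_of_continuous χ' hχ'c
  -- the Levi datum `τ = σ₂ ⊠ χ′`
  set τ : Representation ℂ (Π a : Bool, GL {i : Fin 3 // (![false, false, true] : Fin 3 → Bool) i = a} F) W :=
    Representation.twist ((σ₂.comp (reindexGL e).symm.toMonoidHom).comp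
      (Pi.evalMonoidHom (fun a : Bool => GL {i : Fin 3 // (![false, false, true] : Fin 3 → Bool) i = a} F) false))
      ((χ'.comp Matrix.GeneralLinearGroup.det).comp
        (Pi.evalMonoidHom (fun a : Bool => GL {i : Fin 3 // (![false, false, true] : Fin 3 → Bool) i = a} F) true)) with hτ
  have hτ_apply : ∀ (m : Π a : Bool, GL {i : Fin 3 // (![false, false, true] : Fin 3 → Bool) i = a} F) (w : W),
      τ m w = ((χ' (Matrix.GeneralLinearGroup.det (m true)) : ℂˣ) : ℂ) • σ₂ ((reindexGL e).symm (m false)) w := fun m w => rfl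
  -- `τ` is unitarizable and smooth
  have hτu : τ.IsUnitarizable := by
    obtain ⟨B, hBs, hBp, hBinv⟩ := hσu
    refine ⟨B, hBs, hBp, fun m v w => ?_⟩
    rw [hτ_apply, hτ_apply, LinearMap.map_smulₛₗ₂, LinearMap.map_smul, hBinv, smul_eq_mul, smul_eq_mul, ← mul_assoc,
      starRingEnd_apply, Complex.star_def, Complex.conj_mul', hχ'u]
    simp
  have hrc : Continuous ((reindexGL e).symm : GL {i : Fin 3 // (![false, false, true] : Fin 3 → Bool) i = false} F → GL (Fin 2) F) := by
    haveI : IsTopologicalRing F := inferInstance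
    exact Units.continuous_map (f := (Matrix.reindexAlgEquiv F F e.symm).toMulEquiv.toMonoidHom) (continuous_id.matrix_reindex e.symm e.symm)
  have hτs : τ.IsSmooth := by
    intro w
    have h1 : IsOpen ((σ₂.stabilizerSubgroup w : Set (GL (Fin 2) F))) := hσs w
    have hdet : Continuous fun m : (Π a : Bool, GL {i : Fin 3 // (![false, false, true] : Fin 3 → Bool) i = a} F) =>
        Matrix.GeneralLinearGroup.det (m true) := Matrix.GeneralLinearGroup.continuous_det.comp (continuous_apply true)
    have hker : IsOpen ((fun m : (Π a : Bool, GL {i : Fin 3 // (![false, false, true] : Fin 3 → Bool) i = a} F) =>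
        Matrix.GeneralLinearGroup.det (m true)) ⁻¹' ((χ'.ker : Subgroup Fˣ) : Set Fˣ)) := hχ'o.preimage hdet
    have hpre : IsOpen ((fun m : (Π a : Bool, GL {i : Fin 3 // (![false, false, true] : Fin 3 → Bool) i = a} F) =>
        (reindexGL e).symm (m false)) ⁻¹' (σ₂.stabilizerSubgroup w : Set (GL (Fin 2) F))) :=
      h1.preimage (hrc.comp (continuous_apply false))
    refine Subgroup.isOpen_mono (H₁ := ((χ'.ker : Subgroup Fˣ).comap (Matrix.GeneralLinearGroup.det.comp
      (Pi.evalMonoidHom (fun a : Bool => GL {i : Fin 3 // (![false, false, true] : Fin 3 → Bool) i = a} F) true))) ⊓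
      ((σ₂.stabilizerSubgroup w).comap ((reindexGL e).symm.toMonoidHom.comp
        (Pi.evalMonoidHom (fun a : Bool => GL {i : Fin 3 // (![false, false, true] : Fin 3 → Bool) i = a} F) false)))) ?_
      (hker.inter hpre)
    intro m hm
    obtain ⟨hm1, hm2⟩ := Subgroup.mem_inf.1 hm
    rw [Subgroup.mem_comap] at hm1 hm2
    rw [Representation.mem_stabilizerSubgroup] at hm2 ⊢
    rw [hτ_apply]
    have h1' : χ' (Matrix.GeneralLinearGroup.det (m true)) = 1 := hm1
    rw [h1', Units.val_one, one_smul]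
    exact hm2
  -- `Π = Ind(τ)` is unitarizable and non-zero
  have hPiu := isUnitarizable_parabolicIndGL_of_isUnitarizable F (![false, false, true] : Fin 3 → Bool) τ hτu
  haveI hPi0 := Literature.NumberTheory.Automorphic.nontrivial_parabolicIndGL F (![false, false, true] : Fin 3 → Bool)
    K2E3GL3InductionInStagesEmbedding.monotone_twoOne τ hτs
  -- the `GL₂(F)`-representation as a `SmoothIrrep`
  let r₀ : SmoothIrrep (GL (Fin 2) F) := { V := W, ρ := σ₂, isIrreducible := hσi, isSmooth := hσs }
  by_cases hsc : σ₂.IsSupercuspidal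
  · -- SUPERCUSPIDAL `σ₂`
    exact isIrreducible_parabolicIndGL_box_of_isSupercuspidal e he σ₂ hσi hσs hsc χ' hχ'c
  · -- NON-SUPERCUSPIDAL `σ₂`: non-zero Borel Jacquet module (Harish-Chandra), `σ₂ ↪ I(x, y)`
    have hJ : ¬ Subsingleton (Representation.restrictUnipotentGL F (id : Fin 2 → Fin 2) σ₂).Coinvariants := by
      intro hsub
      apply hsc
      refine (Literature.NumberTheory.Automorphic.isSupercuspidal_iff_jacquetGL_holds F σ₂ hσs).2 fun r c hc hcm => ?_
      have hcs : Function.Surjective c := ((isProperBlocks_iff_two_le c).1 hc).1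
      have hr2 : 2 ≤ r := ((isProperBlocks_iff_two_le c).1 hc).2
      have hr2' : r ≤ 2 := by simpa using Fintype.card_le_of_surjective c hcs
      obtain rfl : r = 2 := le_antisymm hr2' hr2
      obtain rfl : c = id := K2E3TwoBlockCuspidalSupportEmbedding.eq_id_of_monotone_surjective hcm hcs
      exact hsub
    obtain ⟨χ₀, hχ₀, φ, hφ⟩ := K2E3GLnPrincipalBlockEmbedding.exists_character_injective_intertwiningMap_parabolicIndGL r₀ hJ
    obtain ⟨θ, hθo, hθ⟩ := K2E3GL2PrincipalBlockCases.exists_tch_eq χ₀ hχ₀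
    subst hθ
    obtain ⟨x, y, rfl⟩ : ∃ x y : Fˣ →* ℂˣ, θ = ![x, y] := ⟨θ 0, θ 1, K2E3GL2PrincipalBlockCases.eq_vec_two θ⟩
    have hxo : IsOpen ((x.ker : Subgroup Fˣ) : Set Fˣ) := hθo 0
    have hyo : IsOpen ((y.ker : Subgroup Fˣ) : Set Fˣ) := hθo 1
    -- unitarity of the central character: `‖x u‖ ‖y u‖ = 1`
    have hcen : ∀ u : Fˣ, ‖((x u : ℂˣ) : ℂ)‖ * ‖((y u : ℂˣ) : ℂ)‖ = 1 :=
      norm_mul_norm_eq_one_of_injective_principalSeries_two σ₂ hσu x y φ hφ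
    -- the three letters
    set θ₃ : Fin 3 → (Fˣ →* ℂˣ) := ![x, y, χ'] with hθ₃
    have hθ₃o : ∀ a, IsOpen (((θ₃ a).ker : Subgroup Fˣ) : Set Fˣ) := by
      intro a; fin_cases a
      · exact hxo
      · exact hyo
      · exact hχ'o
    -- `Π ↪ Ind(I(x,y) ⊠ χ′) ≅ I(x, y, χ′)`
    let ψ : τ.IntertwiningMap (Representation.twist (((Representation.parabolicIndGL F (id : Fin 2 → Fin 2)
        ((Representation.trivial ℂ (Π a : Fin 2, GL {i : Fin 2 // (id : Fin 2 → Fin 2) i = a} F) ℂ).twist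
          (∏ a : Fin 2, ((![x, y] : Fin 2 → (Fˣ →* ℂˣ)) a).comp (Matrix.GeneralLinearGroup.det.comp
            (Pi.evalMonoidHom (fun a : Fin 2 => GL {i : Fin 2 // (id : Fin 2 → Fin 2) i = a} F) a))))).comp
          (reindexGL e).symm.toMonoidHom).comp
        (Pi.evalMonoidHom (fun a : Bool => GL {i : Fin 3 // (![false, false, true] : Fin 3 → Bool) i = a} F) false))
        ((χ'.comp Matrix.GeneralLinearGroup.det).comp
          (Pi.evalMonoidHom (fun a : Bool => GL {i : Fin 3 // (![false, false, true] : Fin 3 → Bool) i = a} F) true))) :=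
      { toLinearMap := φ.toLinearMap
        isIntertwining' := fun m => by
          refine LinearMap.ext fun w => ?_
          simp only [LinearMap.coe_comp, Function.comp_apply]
          rw [hτ_apply, map_smul, Representation.twist_apply]
          congr 1
          exact LinearMap.congr_fun (φ.isIntertwining' ((reindexGL e).symm (m false))) w }
    have hψ : Function.Injective ψ := hφ
    obtain ⟨Φ, -⟩ := K2E3GL3InductionInStagesEquiv.exists_equiv_parabolicIndGL_twoOne_box e he x y χ'
    let ι := Φ.toIntertwiningMap.comp (Representation.parabolicIndGLMap F (![false, false, true] : Fin 3 → Bool) ψ)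
    have hι : Function.Injective ι :=
      Φ.toLinearEquiv.injective.comp (Representation.parabolicIndGLMap_injective F (![false, false, true] : Fin 3 → Bool) hψ)
    -- `Π` is admissible (a subrepresentation of the admissible `I(x,y,χ′)`) and completely reducible
    have hI3a : (Representation.parabolicIndGL F (id : Fin 3 → Fin 3)
        ((Representation.trivial ℂ (Π a : Fin 3, GL {i : Fin 3 // (id : Fin 3 → Fin 3) i = a} F) ℂ).twist
          (∏ a : Fin 3, (θ₃ a).comp (Matrix.GeneralLinearGroup.det.comp
            (Pi.evalMonoidHom (fun a : Fin 3 => GL {i : Fin 3 // (id : Fin 3 → Fin 3) i = a} F) a))))).IsAdmissible :=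
      Representation.isAdmissible_parabolicIndGL_holds F (id : Fin 3 → Fin 3) _
        (Liu2021.SplitPlace.isAdmissible_trivial_twist _ (K2E3GL3StandardModuleEmbedding.isOpen_ker_tch θ₃ hθ₃o))
    have hPis : (Representation.parabolicIndGL F (![false, false, true] : Fin 3 → Bool) τ).IsSmooth :=
      Representation.isSmooth_smoothInd _ _
    have hPia : (Representation.parabolicIndGL F (![false, false, true] : Fin 3 → Bool) τ).IsAdmissible :=
      Representation.IsAdmissible.of_injective hPis ι hι hI3a
    obtain ⟨K₀, hK₀c, hK₀o, -⟩ := Literature.NumberTheory.Automorphic.exists_isCompact_isOpen_forall_standardParabolicGL_mul F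
      (![false, false, true] : Fin 3 → Bool)
    have hPiss : (Representation.parabolicIndGL F (![false, false, true] : Fin 3 → Bool) τ).IsSemisimpleRepresentation :=
      hPiu.isSemisimpleRepresentation_of_isAdmissible hPia hK₀o hK₀c
    by_cases hreg : Function.Injective θ₃
    · -- REGULAR letters
      exact isIrreducible_of_injective_principalSeries_three_of_regular _ hPiss θ₃ hθ₃o hreg ι hι
    · -- NON-REGULAR letters: all three have unit modulus, hence are pairwise unlinked
      have hmod : (∀ t, ‖((x t : ℂˣ) : ℂ)‖ = 1) ∧ (∀ t, ‖((y t : ℂˣ) : ℂ)‖ = 1) := by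
        have key : ∀ t, ‖((x t : ℂˣ) : ℂ)‖ = 1 ∨ ‖((y t : ℂˣ) : ℂ)‖ = 1 → ‖((x t : ℂˣ) : ℂ)‖ = 1 ∧ ‖((y t : ℂˣ) : ℂ)‖ = 1 := by
          intro t h
          rcases h with h | h
          · refine ⟨h, ?_⟩; have := hcen t; rwa [h, one_mul] at this
          · refine ⟨?_, h⟩; have := hcen t; rwa [h, mul_one] at this
        -- a coincidence among `x, y, χ′`
        have hcases : x = y ∨ x = χ' ∨ y = χ' := by
          by_contra hne
          push Not at hne
          apply hreg
          intro i j hij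
          fin_cases i <;> fin_cases j
          · rfl
          · exact absurd hij hne.1
          · exact absurd hij hne.2.1
          · exact absurd hij.symm hne.1
          · rfl
          · exact absurd hij hne.2.2
          · exact absurd hij.symm hne.2.1
          · exact absurd hij.symm hne.2.2
          · rfl
        rcases hcases with h | h | h
        · have hx1 : ∀ t, ‖((x t : ℂˣ) : ℂ)‖ = 1 := by
            intro t
            have := hcen t
            rw [← h] at this
            have h0 : 0 ≤ ‖((x t : ℂˣ) : ℂ)‖ := norm_nonneg _
            nlinarith [this, h0]
          exact ⟨hx1, fun t => (key t (Or.inl (hx1 t))).2⟩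
        · exact ⟨fun t => by rw [h]; exact hχ'u t, fun t => (key t (Or.inl (by rw [h]; exact hχ'u t))).2⟩
        · exact ⟨fun t => (key t (Or.inr (by rw [h]; exact hχ'u t))).1, fun t => by rw [h]; exact hχ'u t⟩
      have hmod3 : ∀ a t, ‖((θ₃ a t : ℂˣ) : ℂ)‖ = 1 := by
        intro a t; fin_cases a
        · exact hmod.1 t
        · exact hmod.2 t
        · exact hχ'u t
      have hunl : ∀ i j : Fin 3, i ≠ j → θ₃ j ≠ θ₃ i * ((unramifiedTwist F 1 : QuasiChar F).toMonoidHom) :=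
        fun i j _ => ne_mul_unramifiedTwist_of_norm_eq_one (θ₃ i) (θ₃ j) (hmod3 i) (hmod3 j)
      -- `I(x, y, χ′)` is irreducible
      haveI hI3 : (Representation.parabolicIndGL F (id : Fin 3 → Fin 3)
          ((Representation.trivial ℂ (Π a : Fin 3, GL {i : Fin 3 // (id : Fin 3 → Fin 3) i = a} F) ℂ).twist
            (∏ a : Fin 3, (θ₃ a).comp (Matrix.GeneralLinearGroup.det.comp
              (Pi.evalMonoidHom (fun a : Fin 3 => GL {i : Fin 3 // (id : Fin 3 → Fin 3) i = a} F) a))))).IsIrreducible := by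
        by_cases hall : θ₃ 0 = θ₃ 1 ∧ θ₃ 1 = θ₃ 2
        · have h3 : θ₃ = ![χ', χ', χ'] := by
            have h01 : x = y := hall.1
            have h12 : y = χ' := hall.2
            rw [hθ₃, h01, h12]
          rw [h3]
          exact K2E3GL3UnitaryPrincipalSeriesIrregular.isIrreducible_parabolicIndGL_id_three_self χ' hχ'o
        · exact K2E3GL3PrincipalSeriesIrreducibleUnlinked.isIrreducible_principalSeries_three_of_unlinked θ₃ hθ₃o
            (K2E3GL3PrincipalSeriesThreeCell.principalSeriesThreeCell_of_middle_of_open (F := F)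
              (fun χ₁ => K2E3GL3BorelInducedJacquetQMiddleCell.exists_middleCellMap χ₁)
              (fun χ₁ => K2E3GL3BorelInducedJacquetQOpenCell.openCell_letter χ₁) _)
            hunl hall
      exact isIrreducible_of_injective_of_isIrreducible ι hι

end Main


end Summit.HodgeConjecture.HodgeConjecture.R90.S1

end
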